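import Summits.BirchSwinnertonDyer.Rank1Residual.Additive.GordEvenCongruentPartnerBSD
import Summits.BirchSwinnertonDyer.Rank1Residual.Additive.GordEvenCongruentTorsionIsoRecords
import Summits.BirchSwinnertonDyer.Rank1Residual.Additive.GordEvenCongruentTorsionIsoMinimal
import HarnessLib

/-!
# The e346 END-of-ENDs `T-E346-TP` — ONE per-row EXEMPLAR (r2 ROUTE-2 §II.30.6 ST-30.2):
# `BSD(131100f1, 5)` from the STANDING printed facts and an explicit list of census / certificate
# binders, the congruence link I1 being the KERNEL RECORD `torsionIso_300c1_131100f1` (T-I1-H5)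
# (cell `b2b-bsdres`, team n1011, seat p07 (gen 9); composition of `GordEvenCongruentPartnerBSD` §B′
# p301613 with T-I1-H5 parts 1–3 p302176 / p303309 / p304869)

HONEST FRAMING (cell `b2b-bsdres`, run/shared/lean/b2b/bsd-rank1-residual/, verbatim in every
file): the goal of the cell is to DELETE the COMBINATION-SHAPED residual classes of the
Birch–Swinnerton-Dyer formula for ALL analytic-rank `≤ 1` elliptic curves over `ℚ` — "full BSD
formula for every rank `≤ 1` curve in class `C`" assembled STRICTLY from published theorems — so
that the rank-`≤ 1` remainder becomes exactly the CONSTRUCTION-SHAPED classes, which are TYPED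
(missing-input `Prop`s), NOT attempted. This is not "finishing BSD". Team n1011 (N10/N11, the
X4♯(G-ord) e346 receivers at `p = 5`): research route; labels and marks UNCHANGED; nothing booked;
census / instrument output = EVIDENCE, never a Literature fact. ONE assembly theorem; NO definition,
NO named fact, NO new named-fact debt. It CLOSES NOTHING: its value is to make the residual price of
the row 131100f1 @ 5 a VISIBLE binder list — every non-printed hypothesis below is a census column or
a certificate the census / instrument lanes must fill (EVIDENCE tier), and the printed facts
`hC hDelA hDelM hDel hGZK hmod hGV hCG hF'` STAND (registered named facts; `hDelA` flag
`Del02-ThmB-ellp-anomalous`).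

## The binder list of `E346Links.bsdp_C131100f1_five` (receiver 131100f1, partner 300c1, `p = 5`)

PRINTED (standing): `hF'` Fisher 2013 Thm. 5.8 · `hC` `hDelA` `hDelM` Delbourgo 2002 (C), (A)+(B),
(A) on (M) · `hDel` Delbourgo 1998 Prop. 4 · `hGZK` Gross–Zagier–Kolyvagin · `hmod` modularity ·
`hGV` Greenberg–Vatsal 2000 §2 (A240) · `hCG` Coates–Greenberg 1996 (R). CENSUS COLUMNS (EVIDENCE):
receiver `hX : ClassX4Gord C131100f1 5`, `hcm`, `hr : r_an = 0`, `he : e = 4`; partner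
`hX₁ : ClassX4Gord C300c1 5`, `hcm₁`, `he₁ : e = 4`, `hr₁`, `htam₁ : 5 ∤ ∏ c_ℓ`, `hL₁` (unit
`L(E₁,1)/Ω`), `hbsd₁ : BSDp C300c1 5` (census-CLOSED partner), `hna₁` (literal non-anomaly, NA5_lit);
X4-3 tuple `h`, `hf`, `hχ`; Birch × Pal unit `hq`, `hu`; `#Ш_an` unit `hs`, `hv`. KERNEL (no binder):
I1 = `torsionIso_300c1_131100f1 hF'` (indirect Hesse certificate, T-I1-H5), `IsElliptic` /
`IsGloballyMinimal` instances of both curves (T-I1-H5 parts 1 / 3). Nothing booked; census −0.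

References: as in `GordEvenCongruentPartnerBSD`; T. Fisher, Math. Ann. 356 (2013) Thm. 5.8
[Fisher2013QuinticTwists]; cells/n1011/ROUTE-2.md §II.30.6 (ST-30.2).
-/

set_option autoImplicit false

noncomputable section

open scoped Classical MatrixGroups ModularForm NumberField

open CongruenceSubgroup WeierstrassCurve NumberField IsDedekindDomain Field
  Literature.NumberTheory.EllipticCurves
  Literature.NumberTheory.EllipticCurves.ModularForms
  Literature.NumberTheory.EllipticCurves.Rank1Residual
  Literature.NumberTheory.EllipticCurves.Rank1Residual.Typed
  Literature.NumberTheory.EllipticCurves.Delbourgo2002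
  Literature.NumberTheory.EllipticCurves.Greenberg1999
  Literature.NumberTheory.EllipticCurves.GreenbergVatsal2000
  Literature.NumberTheory.EllipticCurves.CoatesGreenberg1996
  Literature.NumberTheory.EllipticCurves.Fisher2012

namespace Summit.BirchSwinnertonDyer.Rank1Residual.Additive

open Summit.BirchSwinnertonDyer.Rank1Residual.X1.CongruenceTransfer

open Summit.BirchSwinnertonDyer.Rank1Residual.Additive.E346Links
  Literature.NumberTheory.EllipticCurves.Fisher2012

variable {p : ℕ} [hp : Fact p.Prime]

/-- **EXEMPLAR (ST-30.2): `BSD(131100f1, 5)` modulo the standing printed facts and the explicit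
census / certificate binders of the row** — `GordEvenCongruentPartnerBSD` §B′ with receiver
`C131100f1`, partner `C300c1` (both `(5;4)`, X4♯(G-ord)), and the link supplied by the KERNEL RECORD
`torsionIso_300c1_131100f1 hF'` (indirect Hesse certificate). Closes nothing: the census-column
binders are EVIDENCE-tier hypotheses; nothing booked. [cite: Fisher2013QuinticTwists, Thm. 5.8]
[cite: Delbourgo2002, Theorem (A), (B), (C) (p. 40), case r_E = 0, ℓ_p(E) = 1 (p. 39)]
[cite: Delbourgo1998, Prop. 4 (p. 144)]
[cite: GreenbergVatsal2000, §2 Prop. (2.8) with Remark (2.9), Cor. (2.3), pp. 26–27 (arXiv:math/9906215)] -/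
theorem E346Links.bsdp_C131100f1_five (hp5 : p = 5)
    (hF' : thm58_fiveCongruent_hessePencilInd)
    (hC : Delbourgo2002.thmC_charIdeal_dvd_tameBranch)
    (hDelA : Delbourgo2002.mainTheorem) (hDelM : Delbourgo2002.mainTheorem_potMult)
    (hDel : Delbourgo1998.prop4_rankZero_pow_dvd_constantCoeff)
    (hGZK : rank_eq_analyticRank_of_analyticRank_le_one) (hmod : hasEntireLFunction_rat)
    (hGV : muLambdaAlg_transfer_of_torsionIso_potOrd_of_not_dvd_torsionOrder)
    (hCG : H1_goodModelKernel_trivial.{0})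
    -- receiver census columns
    (hX : ClassX4Gord C131100f1 p) (hcm : ¬ C131100f1.HasCM) (hr : C131100f1.analyticRank = 0)
    (he : semistabilityIndex C131100f1 p = 4)
    -- partner census columns (trivial `p`-arithmetic + literal non-anomaly)
    (hX₁ : ClassX4Gord C300c1 p) (hcm₁ : ¬ C300c1.HasCM) (he₁ : semistabilityIndex C300c1 p = 4)
    (hr₁ : C300c1.analyticRank = 0) (htam₁ : ¬ p ∣ C300c1.tamagawaProduct)
    (hL₁ : ∃ q : ℚ, q ≠ 0 ∧ C300c1.entireLFunction 1 / (C300c1.realPeriodRat : ℂ) = (q : ℂ) ∧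
      padicValRat p q = 0)
    (hbsd₁ : BSDp C300c1 p) (hna₁ : Delbourgo2002.ReductionNonAnomalous C300c1 p)
    -- X4-3 tuple (EVIDENCE tier)
    (h : CensusX43.OrdinaryTwistPartnerAt C131100f1 p)
    {N : ℕ} [NeZero N] {f : CuspForm (Gamma0 N) 2} (hf : IsNewformOf C131100f1 f)
    {χ : MulChar (ZMod p) ℚ_[p]}
    (hχ : CensusX43.IsTeichmullerPow χ (CensusX43.ordinaryTeichmullerExponent C131100f1 p))
    -- Birch × Pal unit, #Ш_an unit
    {q : ℚ} (hq : C131100f1.entireLFunction 1 = (q : ℂ) * (C131100f1.realPeriodRat : ℂ))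
    {u : ℤ_[p]ˣ} (hu : ((ratPlusSymbol f 0 : ℚ) : ℚ_[p]) = ((u : ℤ_[p]) : ℚ_[p]) * (q : ℚ_[p]))
    {s : ℚ} (hs : shaAn C131100f1 = (s : ℂ)) (hv : padicValRat p s = 0) : BSDp C131100f1 p := by
  subst hp5
  exact hX.bsdp_rankZero_five_four_of_trivialPartner_of_shaAn_unit rfl hC hDelA hDelM hDel hGZK hmod
    hGV hCG hcm hr he hX₁ hcm₁ he₁ hr₁ htam₁ hL₁ hbsd₁ hna₁ (torsionIso_300c1_131100f1 hF') h hf hχ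
    hq hu hs hv

end Summit.BirchSwinnertonDyer.Rank1Residual.Additive

end
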